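import Summits.CriticalPhenomena.PercolationContinuityZ3.Theorems.PercNearOneGluingNoHeavyQuantFarTwoTerminalLaw
import Summits.CriticalPhenomena.PercolationContinuityZ3.Theorems.PercNearOneGluingNoHeavyLowerTailFrontierDecRowsClusterDecoupling
import HarnessLib

/-!
# QUANT lane R8, front "FAR beyond trees", layer one — TWO-TERMINAL BLOCKS IV: CLUSTER-DECOUPLING rows for the outside law (the `CDI` family
# of the two-terminal LP, in the cell vocabulary of `…TwoTerminalLaw`)

builds on p205010 (kernel theorem, internal audit signed; external expert review pending)

Support file (`--supports stmt-CriticalPhenomena-4575`), seat `prim-quant-p1` (gen 25); memo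
`run/shared/lean/prim/quant/prim-quant-p1-g25/FOR-LEAD-TWOTERMINAL.md` §4, §10(a).  Standard axioms; no sorries; no definitions.

The two-terminal environment LP (memo §4) needs, beyond Harris, the CLUSTER-DECOUPLING inequalities (`CDI`): for a pattern `F` of the cluster of a
vertex `s` and an increasing connection event `U` among points that `F` keeps OUT of the cluster, `P(F ∩ U) ≤ P(F)·P(U)` (conditioning on the cluster,
`U` is read off a subgraph).  The principle is in the tree as `ClusterDecoupling.sep_clusterPattern_decoupling` (prim-facecert gen 6).  Here it is
transported to the OUTSIDE law of a two-terminal block: every off-`Z` event has the same probability under `v` and under `v` switched off on the pairs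
meeting `Z` (`Block.real_offZ_eq_real_switchOff`), and under the switched-off weights the whole configuration lives off `Z` a.s.
(`Block.real_switchOff_congr`), so whole-graph cluster rows become off-`Z` rows:
* `Block.real_offZ_cdi` — for any vertex `s`, sets `J` (joined to `s` off `Z`), `X` (separated from `s` off `Z`) and `P, Q` with `Q ⊆ X`:
  `P_v(F_off ∩ {∃ p ∈ P, q ∈ Q, p ~ q off Z}) ≤ P_v(F_off) · P_v(∃ p ∈ P, q ∈ Q, p ~ q off Z)`, `F_off = {s ~ J off Z, s ≁ X off Z}`;
* `Block.real_oneGate_attached_le` — the o-cluster row of the LP at type level: `P(O₁ ∩ {some b ∈ B joined to c₂ off Z}) ≤ P(O₁)·P(some b ∈ B ~ c₂ off Z)`,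
  `O₁ = {o ~ c₁ ∧ ¬ o ~ c₂ off Z}` (and its mirror by symmetry of the statement);
* `Block.real_unattached_through_le` — `P(o ≁ c₁, o ≁ c₂ off Z ∧ c₁ ~ c₂ off Z) ≤ P(o ≁ c₁, o ≁ c₂ off Z) · P(c₁ ~ c₂ off Z)`.
[cite: Grimmett1999, §2.2] (events determined by finitely many coordinates); the rows are [this work] on top of `ClusterDecoupling` (van den Berg–Häggström–Kahn
2006 §1 as vendored there).
-/

noncomputable section

namespace Summit.CriticalPhenomena.PercolationContinuityZ3.Theorems

namespace Quant

namespace Block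

open Finset MeasureTheory Set
open Literature.Probability.LatticeModels
open Literature.Probability.Percolation
open Bundle (offZ avoid offZ_eq_inter determinedBy_offZ reachable_of_offZ offZ_subset)
open scoped Classical

variable {n : ℕ}

section CDI

variable {Z : Finset (Fin n)}

/-- Off-`Z` events do not see the weights on the pairs meeting `Z`: switching those weights off changes nothing. [this work] -/
theorem real_offZ_eq_real_switchOff (v : Sym2 (Fin n) → unitInterval) (Z : Finset (Fin n)) (P : BondConfig (Fin n) → Prop) :
    (prodBernoulli v).real {ω | P (offZ Z ω)} =
      (prodBernoulli (fun e => if e ∈ avoid Z then v e else 0)).real {ω | P (offZ Z ω)} :=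
  Bundle.real_offZ_event_eq_of_agree v _ Z (fun e he => by simp only [he, if_true]) P

/-- Under the switched-off weights the configuration lives off `Z` almost surely: `{ω | P (offZ Z ω)}` and `{ω | P ω}` have the same probability.
[this work] -/
theorem real_switchOff_congr (v : Sym2 (Fin n) → unitInterval) (Z : Finset (Fin n)) (P : BondConfig (Fin n) → Prop) :
    (prodBernoulli (fun e => if e ∈ avoid Z then v e else 0)).real {ω | P (offZ Z ω)} =
      (prodBernoulli (fun e => if e ∈ avoid Z then v e else 0)).real {ω | P ω} := by
  set v' : Sym2 (Fin n) → unitInterval := fun e => if e ∈ avoid Z then v e else 0 with hv'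
  set μ := prodBernoulli v' with hμ
  have hmeas : ∀ U : Set (BondConfig (Fin n)), MeasurableSet U := fun U => (Set.toFinite U).measurableSet
  set Bd : Finset (Sym2 (Fin n)) := Finset.univ.filter fun e => e ∉ avoid Z with hBd
  set Nbad : Set (BondConfig (Fin n)) := {ω | ∃ e ∈ Bd, e ∈ ω} with hN
  have hN0 : μ.real Nbad = 0 := by
    have h0 : μ Nbad = 0 := by
      apply prodBernoulli_setOf_exists_mem_eq_zero
      intro e he
      have he' : e ∉ avoid Z := (Finset.mem_filter.1 he).2
      simp only [hv', he', if_false]; rfl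
    simp [measureReal_def, h0]
  have hgood : ∀ ω : BondConfig (Fin n), ω ∉ Nbad → offZ Z ω = ω := by
    intro ω hω
    rw [offZ_eq_inter]
    ext e
    simp only [Set.mem_inter_iff, Finset.mem_coe]
    constructor
    · exact fun h => h.1
    · intro he
      refine ⟨he, ?_⟩
      by_contra hea
      exact hω ⟨e, Finset.mem_filter.2 ⟨Finset.mem_univ _, hea⟩, he⟩
  have hsplit : ∀ U : Set (BondConfig (Fin n)), μ.real U = μ.real (U \ Nbad) := by
    intro U
    have h := measureReal_inter_add_sdiff (μ := μ) (s := U) (hmeas Nbad)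
    have h0 : μ.real (U ∩ Nbad) = 0 :=
      le_antisymm ((measureReal_mono Set.inter_subset_right).trans hN0.le) measureReal_nonneg
    linarith
  have hdiff : {ω | P (offZ Z ω)} \ Nbad = {ω | P ω} \ Nbad := by
    ext ω
    simp only [Set.mem_sdiff, mem_setOf_eq]
    constructor
    · rintro ⟨h, hω⟩; exact ⟨by rwa [hgood ω hω] at h, hω⟩
    · rintro ⟨h, hω⟩; exact ⟨by rwa [hgood ω hω], hω⟩
  rw [hsplit {ω | P (offZ Z ω)}, hsplit {ω | P ω}, hdiff]

/-- **Cluster decoupling for the outside law** (`CDI`).  For a vertex `s`, vertex sets `J` ("joined to `s` off `Z`"), `X` ("separated from `s` off `Z`")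
and `P, Q` with `Q ⊆ X`:
`P(F ∩ {∃ p ∈ P, ∃ q ∈ Q, p ~ q off Z}) ≤ P(F) · P(∃ p ∈ P, ∃ q ∈ Q, p ~ q off Z)` where `F = {∀ j ∈ J, s ~ j off Z} ∩ {∀ x ∈ X, ¬ s ~ x off Z}` —
conditionally on an exact pattern of the off-`Z` cluster of `s`, a connection among points off that cluster is LESS likely. [this work] -/
theorem real_offZ_cdi (v : Sym2 (Fin n) → unitInterval) (Z : Finset (Fin n)) (s : Fin n) (J X P Q : Set (Fin n)) (hQ : Q ⊆ X) :
    (prodBernoulli v).real {ω | ((∀ j ∈ J, offZ Z ω ∈ openConn s j) ∧ ∀ x ∈ X, offZ Z ω ∉ openConn s x) ∧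
        ∃ p ∈ P, ∃ q ∈ Q, offZ Z ω ∈ openConn p q} ≤
      (prodBernoulli v).real {ω | (∀ j ∈ J, offZ Z ω ∈ openConn s j) ∧ ∀ x ∈ X, offZ Z ω ∉ openConn s x} *
        (prodBernoulli v).real {ω | ∃ p ∈ P, ∃ q ∈ Q, offZ Z ω ∈ openConn p q} := by
  set v' : Sym2 (Fin n) → unitInterval := fun e => if e ∈ avoid Z then v e else 0 with hv'
  set μ := prodBernoulli v' with hμ
  have hmeas : ∀ U : Set (BondConfig (Fin n)), MeasurableSet U := fun U => (Set.toFinite U).measurableSet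
  -- move everything to `v'` and to whole-graph events
  set P1 : BondConfig (Fin n) → Prop := fun η => ((∀ j ∈ J, η ∈ openConn s j) ∧ ∀ x ∈ X, η ∉ openConn s x) ∧
    ∃ p ∈ P, ∃ q ∈ Q, η ∈ openConn p q with hP1
  set P2 : BondConfig (Fin n) → Prop := fun η => (∀ j ∈ J, η ∈ openConn s j) ∧ ∀ x ∈ X, η ∉ openConn s x with hP2
  set P3 : BondConfig (Fin n) → Prop := fun η => ∃ p ∈ P, ∃ q ∈ Q, η ∈ openConn p q with hP3
  have t1 : (prodBernoulli v).real {ω | P1 (offZ Z ω)} = (prodBernoulli v').real {ω | P1 ω} :=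
    (real_offZ_eq_real_switchOff v Z P1).trans (real_switchOff_congr v Z P1)
  have t2 : (prodBernoulli v).real {ω | P2 (offZ Z ω)} = (prodBernoulli v').real {ω | P2 ω} :=
    (real_offZ_eq_real_switchOff v Z P2).trans (real_switchOff_congr v Z P2)
  have t3 : (prodBernoulli v).real {ω | P3 (offZ Z ω)} = (prodBernoulli v').real {ω | P3 ω} :=
    (real_offZ_eq_real_switchOff v Z P3).trans (real_switchOff_congr v Z P3)
  show (prodBernoulli v).real {ω | P1 (offZ Z ω)} ≤ (prodBernoulli v).real {ω | P2 (offZ Z ω)} * (prodBernoulli v).real {ω | P3 (offZ Z ω)}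
  rw [t1, t2, t3]
  -- the whole-graph row under `v'`
  set F : Set (BondConfig (Fin n)) := {ω | (∀ j ∈ J, (openGraph ω).Reachable s j) ∧ ∀ x ∈ X, ¬ (openGraph ω).Reachable s x} with hF
  set D : Set (BondConfig (Fin n)) := {ω | ∀ p ∈ P, ∀ q ∈ Q, ¬ (openGraph ω).Reachable p q} with hD
  have hrow := ClusterDecoupling.sep_clusterPattern_decoupling v' s J X (∅ : Set (Fin n)) (∅ : Set (Fin n)) P Q (Set.empty_subset X) hQ
  have hD0 : {ω : BondConfig (Fin n) | ∀ p ∈ (∅ : Set (Fin n)), ∀ q ∈ (∅ : Set (Fin n)), ¬ (openGraph ω).Reachable p q} = Set.univ := by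
    ext ω; simp
  rw [hD0, Set.inter_univ, Set.univ_inter] at hrow
  -- `hrow : μ F * μ D ≤ μ (F ∩ D)`; complement
  have hFsplit : (prodBernoulli v').real F = (prodBernoulli v').real (F ∩ D) + (prodBernoulli v').real (F ∩ Dᶜ) := by
    rw [← measureReal_inter_add_sdiff (μ := prodBernoulli v') (s := F) (hmeas D)]; rfl
  have hDc : (prodBernoulli v').real Dᶜ = 1 - (prodBernoulli v').real D := probReal_compl_eq_one_sub (hmeas D)
  have hE3 : {ω : BondConfig (Fin n) | P3 ω} = Dᶜ := by
    ext ω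
    simp only [hP3, hD, Set.mem_compl_iff, mem_setOf_eq, not_forall, not_not, exists_prop]
    rfl
  have hE2 : {ω : BondConfig (Fin n) | P2 ω} = F := rfl
  have hE1 : {ω : BondConfig (Fin n) | P1 ω} = F ∩ Dᶜ := by
    rw [← hE3, ← hE2]; ext ω; simp only [hP1, hP2, hP3, Set.mem_inter_iff, mem_setOf_eq]
  rw [hE1, hE2, hE3, hDc]
  have hF1 : (prodBernoulli v').real F ≤ 1 := measureReal_le_one
  nlinarith [hrow, hFsplit]

variable {o c₁ c₂ : Fin n}

/-- **The o-cluster row at type level** (two-terminal LP, memo §4): for any set `B` of vertices,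
`P(o ~ c₁ ∧ ¬ o ~ c₂ off Z ∧ ∃ b ∈ B, b ~ c₂ off Z) ≤ P(o ~ c₁ ∧ ¬ o ~ c₂ off Z) · P(∃ b ∈ B, b ~ c₂ off Z)` — given that the observer reaches exactly the
first terminal off the block, relays are not MORE likely to hang at the second one. [this work] -/
theorem real_oneGate_attached_le (v : Sym2 (Fin n) → unitInterval) (Z : Finset (Fin n)) (o c₁ c₂ : Fin n) (B : Set (Fin n)) :
    (prodBernoulli v).real {ω | (offZ Z ω ∈ openConn o c₁ ∧ offZ Z ω ∉ openConn o c₂) ∧ ∃ b ∈ B, offZ Z ω ∈ openConn b c₂} ≤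
      (prodBernoulli v).real {ω | offZ Z ω ∈ openConn o c₁ ∧ offZ Z ω ∉ openConn o c₂} *
        (prodBernoulli v).real {ω | ∃ b ∈ B, offZ Z ω ∈ openConn b c₂} := by
  have h := real_offZ_cdi v Z o {c₁} {c₂} B {c₂} (subset_refl _)
  have e1 : {ω : BondConfig (Fin n) | ((∀ j ∈ ({c₁} : Set (Fin n)), offZ Z ω ∈ openConn o j) ∧ ∀ x ∈ ({c₂} : Set (Fin n)), offZ Z ω ∉ openConn o x) ∧
      ∃ p ∈ B, ∃ q ∈ ({c₂} : Set (Fin n)), offZ Z ω ∈ openConn p q} =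
      {ω | (offZ Z ω ∈ openConn o c₁ ∧ offZ Z ω ∉ openConn o c₂) ∧ ∃ b ∈ B, offZ Z ω ∈ openConn b c₂} := by
    ext ω; simp
  have e2 : {ω : BondConfig (Fin n) | (∀ j ∈ ({c₁} : Set (Fin n)), offZ Z ω ∈ openConn o j) ∧ ∀ x ∈ ({c₂} : Set (Fin n)), offZ Z ω ∉ openConn o x} =
      {ω | offZ Z ω ∈ openConn o c₁ ∧ offZ Z ω ∉ openConn o c₂} := by
    ext ω; simp
  have e3 : {ω : BondConfig (Fin n) | ∃ p ∈ B, ∃ q ∈ ({c₂} : Set (Fin n)), offZ Z ω ∈ openConn p q} =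
      {ω | ∃ b ∈ B, offZ Z ω ∈ openConn b c₂} := by
    ext ω; simp
  rw [e1, e2, e3] at h
  exact h

/-- **The unattached row**: `P(o ≁ c₁ ∧ o ≁ c₂ off Z ∧ c₁ ~ c₂ off Z) ≤ P(o ≁ c₁ ∧ o ≁ c₂ off Z) · P(c₁ ~ c₂ off Z)` — given that the observer reaches
neither terminal off the block, the terminals are not MORE likely to be joined off the block. [this work] -/
theorem real_unattached_through_le (v : Sym2 (Fin n) → unitInterval) (Z : Finset (Fin n)) (o c₁ c₂ : Fin n) :
    (prodBernoulli v).real {ω | (offZ Z ω ∉ openConn o c₁ ∧ offZ Z ω ∉ openConn o c₂) ∧ offZ Z ω ∈ openConn c₁ c₂} ≤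
      (prodBernoulli v).real {ω | offZ Z ω ∉ openConn o c₁ ∧ offZ Z ω ∉ openConn o c₂} *
        (prodBernoulli v).real {ω | offZ Z ω ∈ openConn c₁ c₂} := by
  have h := real_offZ_cdi v Z o (∅ : Set (Fin n)) {c₁, c₂} {c₁} {c₂} (by intro x hx; simp only [Set.mem_singleton_iff] at hx; simp [hx])
  have e1 : {ω : BondConfig (Fin n) | ((∀ j ∈ (∅ : Set (Fin n)), offZ Z ω ∈ openConn o j) ∧ ∀ x ∈ ({c₁, c₂} : Set (Fin n)), offZ Z ω ∉ openConn o x) ∧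
      ∃ p ∈ ({c₁} : Set (Fin n)), ∃ q ∈ ({c₂} : Set (Fin n)), offZ Z ω ∈ openConn p q} =
      {ω | (offZ Z ω ∉ openConn o c₁ ∧ offZ Z ω ∉ openConn o c₂) ∧ offZ Z ω ∈ openConn c₁ c₂} := by
    ext ω; simp
  have e2 : {ω : BondConfig (Fin n) | (∀ j ∈ (∅ : Set (Fin n)), offZ Z ω ∈ openConn o j) ∧ ∀ x ∈ ({c₁, c₂} : Set (Fin n)), offZ Z ω ∉ openConn o x} =
      {ω | offZ Z ω ∉ openConn o c₁ ∧ offZ Z ω ∉ openConn o c₂} := by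
    ext ω; simp
  have e3 : {ω : BondConfig (Fin n) | ∃ p ∈ ({c₁} : Set (Fin n)), ∃ q ∈ ({c₂} : Set (Fin n)), offZ Z ω ∈ openConn p q} =
      {ω | offZ Z ω ∈ openConn c₁ c₂} := by
    ext ω; simp
  rw [e1, e2, e3] at h
  exact h

end CDI

end Block

end Quant

end Summit.CriticalPhenomena.PercolationContinuityZ3.Theorems
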